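/-
Copyright (c) 2026 the pub-hodgecm-mathlib formalisation cell (harness21).  Prover seat hodgecm-mathlib-K2E4-p23 (g2), Track B ∕ K2-LIT, h413 =
`stmt-HodgeConjecture-24833`, ENGINE E1, 5Res campaign, deal (113) of the dealer K2E1-plan (g6) 2026-09-04T11:00:58Z, part (ii-b): the GLOBAL ASSEMBLY — the
circle average of a section along the single-place torus IS ★ `archTorusCoeff` (first half of the `hmc` payer).
-/
import Summits.HodgeConjecture.HodgeConjecture.Theorems.K2E1ArchLocalIwasawaU11     -- ★ p859666 (this seat): `iwasawa_matrix_entries`, `exists_archAt_archPart_eq_circleLoc`; brings (113)(i) defs, F2a defs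
import Mathlib.MeasureTheory.Integral.IntervalIntegral.Periodic
import HarnessLib

/-!
# K2·E1 — `K2E1ArchTorusActionFlatSectionU11`: THE `κ`-ISOTYPIC MATRIX COEFFICIENT OF A SECTION ALONG THE TORUS AT ONE COMPLEX PLACE IS `Φ_{s,p−q}(a)`
# (deal (113)(ii-b): `∫₀^{2π} e^{−iqθ} f(g·k_w(θ)·t_w(a)) dθ = (∫₀^{2π} archTorusIntegrand s (p − q) a θ dθ) · f(g)` — the section-level half of the letter `hmc`)

Track B ∕ K2-LIT, crux h413 = `stmt-HodgeConjecture-24833`, route of record `HCCMUnconditional`; cell `hodgecm-mathlib`, squad K2, ENGINE E1 (5Res campaign, ARCH-UNITARITY leg;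
this seat's design 2026-09-04T11:04Z: average over the one-parameter circle, no `K_∞`-Haar projector).  Prover seat `hodgecm-mathlib-K2E4-p23` (g2); deal (113) of the dealer
K2E1-plan (g6).  THEOREMS ONLY (no `def`, no `instance`, no notation, no named-fact hypothesis, no `sorry`); lane `--supports stmt-HodgeConjecture-24833 --as helper` (count-neutral).
CLOSES NO SOCKET.

THE IDENTITY, for ANY function `f : U(J₂)(𝔸_{L⁺}) → ℂ` carrying three LETTERS at the complex place `w` (for `f = flatSectionU φ z`, `φ` a `χ`-section of `K_w`-type `(p,q)`, `s = z + it_w`,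
they are: (G) ★ `flatSectionU_borel_mul_of_isChiSection`; (K) the `K_w`-type; (B) `χ_w|_{ℝ₊} = r^{2it}` + the local height — payer = the (χ,τ)-campaign):
* (G) `hBglob`: left `B(𝔸)`-equivariance up to SOME scalar, `∀ b ∈ B(𝔸), ∃ c, ∀ x, f(b x) = c·f(x)`;
* (K) `hK`: right `K_w`-type `(p, q)` along ★ `circleAt`: `f(x · circleAt w u v) = u^p v^q f(x)`;
* (B) `hB`: left character of the local Borel at `w` with positive real torus part: `f(adelicSingle w b · x) = (r²)^s f(x)` for `b ∈ U(1,1)` with `b₁₀ = 0`, `b₀₀ = r > 0`.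
THEN for `a > 0` and every `g`:  **`∫₀^{2π} e^{−iqθ}·f(g · circleAt w 1 (e^{iθ}) · torusAt w a) dθ = (∫₀^{2π} archTorusIntegrand s (p − q) a θ dθ) · f(g)`** (`circleAverage_torusAt_eq`), and the
normalised form with ★ `archTorusCoeff` (`circleAverage_torusAt_eq_archTorusCoeff_mul`).  With ★ F2b∕F3 this is the section half of `hmc`; the residue half waits for the (χ,τ)-continuation.
PROOF.  Global Iwasawa `g = b₀k₀` (★ `exists_mem_borelAdelic_mul_mem_standardMaximalCompactGL_cm`), `k₀ = adelicSingle w κ₀ · k′` with `k′ ∈ awayFrom w` central for `adelicSingle w` (★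
`exists_eq_adelicSingle_mul`, ★ `commute_adelicSingle_of_mem_awayFrom`), `κ₀ = circleLoc u₀ v₀` (★ (ii-a)); `circleLoc u₀ v₀ = circleLoc u₀ u₀ · circleLoc 1 (v₀∕u₀)` with the scalar
`circleLoc u₀ u₀` central; local Iwasawa at `ζ′ = e^{i(θ+θ₁)}`, `e^{iθ₁} = v₀∕u₀` (★ (ii-a) `iwasawa_matrix_entries`); the letters turn `f(g·k_w(θ)·t_w(a))` into
`c_{b₀} f(k′) u₀^p · [(4∕|W|²)^s (W∕|W|)^p (ζ′W̄∕|W|)^q u₀^q]` and `f(g)` into `c_{b₀} f(k′) u₀^p v₀^q`; §1 `bracket_eq` identifies `e^{−iqθ}·[…] = v₀^q · archTorusIntegrand s (p−q) a (θ+θ₁)`,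
and the `2π`-periodic integral is shift-invariant (★ `periodic_archTorusIntegrand`).
HONEST LABEL: HC_CM is proved only modulo the 7 printed citations (2 remaining named inputs: hLiu418 = `stmt-HodgeConjecture-24832`, h413 = `stmt-HodgeConjecture-24833`) until rung 0
closes; this file asserts no named fact and closes no socket; count-neutral.

## References
* [Knapp1986] A. W. Knapp, *Representation Theory of Semisimple Groups* (1986), VII §1.
* [BorelJacquet1979] A. Borel, H. Jacquet, PSPM 33.1 (1979), §4.1.
* [MoeglinWaldspurger1995] C. Mœglin, J.-L. Waldspurger (1995), I.2.17, IV.3.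
-/

set_option autoImplicit false
-- the mandated namespace repeats the single-problem summit's segment (`HodgeConjecture.HodgeConjecture`)
set_option linter.dupNamespace false

noncomputable section

open NumberField NumberField.InfinitePlace Matrix MeasureTheory intervalIntegral
open scoped MatrixGroups ComplexConjugate Real
open Literature.NumberTheory.Automorphic Literature.NumberTheory.Automorphic.UnitaryGroup AdelicGroupData
open Summit.HodgeConjecture.HodgeConjecture.Cruxes.H413.K2E1ArchTorusFamilyU11Defs
open Summit.HodgeConjecture.HodgeConjecture.Cruxes.H413.K2E1ArchTorusCoefficientU11Defs
open Summit.HodgeConjecture.HodgeConjecture.Cruxes.H413.K2E1ArchLocalIwasawaU11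

namespace Summit.HodgeConjecture.HodgeConjecture.Cruxes.H413.K2E1ArchTorusActionFlatSectionU11

/-! ## §1 The scalar bookkeeping: `e^{−iqθ}·(r²)^s·u″^p·v″^q·u₀^q = v₀^q · archTorusIntegrand s (p−q) a (θ+θ₁)` -/

/-- `((normSq W ∕ 4)⁻¹ : ℂ)^s = (normSq W ∕ 4)^{−s}` for the positive real base, and `(2∕|W|)² = (normSq W∕4)⁻¹`. [folklore] -/
theorem sq_two_div_norm_cpow {W : ℂ} (hW : W ≠ 0) (s : ℂ) :
    ((((2 / ‖W‖) ^ 2 : ℝ)) : ℂ) ^ s = (((Complex.normSq W / 4 : ℝ)) : ℂ) ^ (-s) := by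
  have hn : 0 < ‖W‖ := norm_pos_iff.2 hW
  have hq : 0 < Complex.normSq W / 4 := by have := Complex.normSq_pos.2 hW; positivity
  have e : ((2 / ‖W‖) ^ 2 : ℝ) = (Complex.normSq W / 4)⁻¹ := by
    rw [Complex.normSq_eq_norm_sq]
    field_simp
    norm_num
  rw [e, Complex.ofReal_inv, Complex.inv_cpow _ _ (by rw [Complex.arg_ofReal_of_nonneg hq.le]; exact Real.pi_pos.ne), Complex.cpow_neg]

/-- **THE BRACKET IDENTITY.**  For `a > 0`, `θ θ₁ : ℝ`, `u₀ v₀ : ℂ` with `u₀ ≠ 0` and `e^{iθ₁} = v₀∕u₀`, `W := W_a(θ+θ₁) ≠ 0`, `U := W∕|W|`: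
`e^{−iqθ}·((2∕|W|)²)^s·U^p·(e^{i(θ+θ₁)}U⁻¹)^q·u₀^q = v₀^q · archTorusIntegrand s (p − q) a (θ + θ₁)`. [folklore] -/
theorem bracket_eq (s : ℂ) (p q : ℤ) {a : ℝ} (ha : 0 < a) (θ θ₁ : ℝ) {u₀ v₀ : ℂ} (hu₀ : u₀ ≠ 0)
    (hθ₁ : Complex.exp ((θ₁ : ℂ) * Complex.I) = v₀ / u₀) :
    Complex.exp (-((q : ℂ) * θ * Complex.I)) * ((((2 / ‖torusW a (θ + θ₁)‖) ^ 2 : ℝ)) : ℂ) ^ s *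
        (torusW a (θ + θ₁) / (‖torusW a (θ + θ₁)‖ : ℂ)) ^ p *
        (Complex.exp (((θ + θ₁ : ℝ) : ℂ) * Complex.I) * (torusW a (θ + θ₁) / (‖torusW a (θ + θ₁)‖ : ℂ))⁻¹) ^ q * u₀ ^ q =
      v₀ ^ q * archTorusIntegrand s (p - q) a (θ + θ₁) := by
  set W : ℂ := torusW a (θ + θ₁) with hWdef
  have hW : W ≠ 0 := torusW_ne_zero ha _
  have hn : (‖W‖ : ℂ) ≠ 0 := Complex.ofReal_ne_zero.2 (norm_ne_zero_iff.2 hW)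
  have hU : W / (‖W‖ : ℂ) ≠ 0 := div_ne_zero hW hn
  rw [archTorusIntegrand, ← hWdef, ← sq_two_div_norm_cpow hW s, zpow_sub₀ hU, mul_zpow, _root_.inv_zpow]
  -- the exponentials: `e^{−iqθ}·e^{iq(θ+θ₁)} = (v₀∕u₀)^q`
  have hexp : Complex.exp (-((q : ℂ) * θ * Complex.I)) * Complex.exp (((θ + θ₁ : ℝ) : ℂ) * Complex.I) ^ q = (v₀ / u₀) ^ q := by
    rw [← hθ₁, ← Complex.exp_int_mul, ← Complex.exp_int_mul, ← Complex.exp_add]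
    congr 1
    push_cast
    ring
  calc Complex.exp (-((q : ℂ) * θ * Complex.I)) * ((((2 / ‖W‖) ^ 2 : ℝ)) : ℂ) ^ s * (W / (‖W‖ : ℂ)) ^ p *
          (Complex.exp (((θ + θ₁ : ℝ) : ℂ) * Complex.I) ^ q * ((W / (‖W‖ : ℂ)) ^ q)⁻¹) * u₀ ^ q
        = (Complex.exp (-((q : ℂ) * θ * Complex.I)) * Complex.exp (((θ + θ₁ : ℝ) : ℂ) * Complex.I) ^ q) * u₀ ^ q *
            (((((2 / ‖W‖) ^ 2 : ℝ)) : ℂ) ^ s * ((W / (‖W‖ : ℂ)) ^ p / (W / (‖W‖ : ℂ)) ^ q)) := by rw [div_eq_mul_inv]; ring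
    _ = v₀ ^ q * (((((2 / ‖W‖) ^ 2 : ℝ)) : ℂ) ^ s * ((W / (‖W‖ : ℂ)) ^ p / (W / (‖W‖ : ℂ)) ^ q)) := by
          rw [hexp, div_zpow, div_mul_cancel₀ _ (zpow_ne_zero q hu₀)]

variable (L : Type) [Field L] (w : {w : InfinitePlace L // IsComplex w})

/-! ## §2 Local group-level facts -/

/-- The scalar `circleLoc u u = u·1` is central in `U(1,1)`. [folklore] -/
theorem circleLoc_self_mul_comm (u : Circle) (X : archLocal L 2 ((StdForm.antidiagonal 2).over L) w) : circleLoc L w u u * X = X * circleLoc L w u u := by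
  apply Subtype.ext
  apply Matrix.GeneralLinearGroup.ext
  intro i j
  change (circleLocMatrix u u * ((X : GL (Fin 2) ℂ) : Matrix (Fin 2) (Fin 2) ℂ)) i j = (((X : GL (Fin 2) ℂ) : Matrix (Fin 2) (Fin 2) ℂ) * circleLocMatrix u u) i j
  rw [circleLocMatrix]
  fin_cases i <;> fin_cases j <;>
    · simp [Matrix.mul_apply, Fin.sum_univ_two]
      ring

/-- `circleLoc u₀ v₀ · circleLoc 1 ζ = circleLoc 1 (u₀⁻¹v₀ζ) · circleLoc u₀ u₀`. [folklore] -/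
theorem circleLoc_mul_circleLoc_one (u₀ v₀ ζ : Circle) :
    circleLoc L w u₀ v₀ * circleLoc L w 1 ζ = circleLoc L w 1 (u₀⁻¹ * v₀ * ζ) * circleLoc L w u₀ u₀ := by
  rw [← circleLoc_mul, ← circleLoc_mul, mul_one, one_mul]
  congr 1
  rw [mul_comm (u₀⁻¹ * v₀ * ζ) u₀, ← mul_assoc, ← mul_assoc, mul_inv_cancel, one_mul]

/-- **The matrix of the local Borel part** `b := circleLoc 1 ζ′ · torusLoc (log a) · (circleLoc u″ v″)⁻¹` with `u″ = e^{i arg W}`, `v″ = ζ′(u″)⁻¹`, `W = W_a(θ′)`, `ζ′ = e^{iθ′}`: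
`b₁₀ = 0` and `b₀₀ = 2∕|W|` (★ (ii-a) `iwasawa_matrix_entries` after unfolding the coercions). [cite: Knapp1986, VII §1] -/
theorem localBorel_entries {a : ℝ} (ha : 0 < a) (θ' : ℝ) :
    ((((circleLoc L w 1 (Circle.exp θ') * torusLoc L w (Real.log a) * (circleLoc L w (Circle.exp (Complex.arg (torusW a θ'))) (Circle.exp θ' * (Circle.exp (Complex.arg (torusW a θ')))⁻¹))⁻¹ :
        archLocal L 2 ((StdForm.antidiagonal 2).over L) w) : GL (Fin 2) ℂ) : Matrix (Fin 2) (Fin 2) ℂ) 1 0 = 0) ∧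
    ((((circleLoc L w 1 (Circle.exp θ') * torusLoc L w (Real.log a) * (circleLoc L w (Circle.exp (Complex.arg (torusW a θ'))) (Circle.exp θ' * (Circle.exp (Complex.arg (torusW a θ')))⁻¹))⁻¹ :
        archLocal L 2 ((StdForm.antidiagonal 2).over L) w) : GL (Fin 2) ℂ) : Matrix (Fin 2) (Fin 2) ℂ) 0 0 = (((2 / ‖torusW a θ'‖ : ℝ)) : ℂ)) := by
  set W : ℂ := torusW a θ' with hWdef
  have hW : W ≠ 0 := torusW_ne_zero ha _
  have hn : (‖W‖ : ℂ) ≠ 0 := Complex.ofReal_ne_zero.2 (norm_ne_zero_iff.2 hW)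
  set ζ : ℂ := Complex.exp ((θ' : ℂ) * Complex.I) with hζ
  set ζb : ℂ := Complex.exp (-((θ' : ℂ) * Complex.I)) with hζb
  have h1 : ζ * ζb = 1 := by rw [hζ, hζb, ← Complex.exp_add, add_neg_cancel, Complex.exp_zero]
  have hζ0 : ζ ≠ 0 := Complex.exp_ne_zero _
  have hWform : W = ((a + a⁻¹ : ℝ) : ℂ) - ζ * ((a - a⁻¹ : ℝ) : ℂ) := by rw [hWdef, torusW_def]
  have hWbform : (starRingEnd ℂ) W = ((a + a⁻¹ : ℝ) : ℂ) - ζb * ((a - a⁻¹ : ℝ) : ℂ) := by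
    rw [hWform, map_sub, map_mul, Complex.conj_ofReal, Complex.conj_ofReal, hζ, ← Complex.exp_conj, map_mul, Complex.conj_ofReal, Complex.conj_I,
      mul_neg, hζb]
  -- the unit `u″ = W ∕ |W|` and the matrix coercions
  have hu : ((Circle.exp (Complex.arg W) : Circle) : ℂ) = W / (‖W‖ : ℂ) := by
    rw [Circle.coe_exp, eq_div_iff hn, mul_comm]
    exact_mod_cast Complex.norm_mul_exp_arg_mul_I W
  have hWWb : W * (starRingEnd ℂ) W = (‖W‖ : ℂ) ^ 2 := by rw [Complex.mul_conj, Complex.normSq_eq_norm_sq]; push_cast; ring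
  have huinv : (W / (‖W‖ : ℂ))⁻¹ = (starRingEnd ℂ) W / (‖W‖ : ℂ) := by
    rw [inv_div, div_eq_div_iff hW hn, ← sq, ← hWWb]
    ring
  have hmat : ((((circleLoc L w 1 (Circle.exp θ') * torusLoc L w (Real.log a) * (circleLoc L w (Circle.exp (Complex.arg W)) (Circle.exp θ' * (Circle.exp (Complex.arg W))⁻¹))⁻¹ :
        archLocal L 2 ((StdForm.antidiagonal 2).over L) w) : GL (Fin 2) ℂ) : Matrix (Fin 2) (Fin 2) ℂ)) =
      !![(1 + ζ) / 2, (1 - ζ) / 2; (1 - ζ) / 2, (1 + ζ) / 2] * !![(a : ℂ), 0; 0, (a : ℂ)⁻¹] *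
        !![((starRingEnd ℂ) W / ‖W‖ + ζb * W / ‖W‖) / 2, ((starRingEnd ℂ) W / ‖W‖ - ζb * W / ‖W‖) / 2;
           ((starRingEnd ℂ) W / ‖W‖ - ζb * W / ‖W‖) / 2, ((starRingEnd ℂ) W / ‖W‖ + ζb * W / ‖W‖) / 2] := by
    rw [← circleLoc_inv, Subgroup.coe_mul, Subgroup.coe_mul, Units.val_mul, Units.val_mul, coe_circleLoc, coe_torusLoc, coe_circleLoc]
    have e1 : circleLocMatrix 1 (Circle.exp θ') = !![(1 + ζ) / 2, (1 - ζ) / 2; (1 - ζ) / 2, (1 + ζ) / 2] := by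
      rw [circleLocMatrix, Circle.coe_one, Circle.coe_exp]
    have e2 : torusLocMatrix (Real.log a) = !![(a : ℂ), 0; 0, (a : ℂ)⁻¹] := by
      rw [torusLocMatrix, Real.exp_log ha, Real.exp_neg, Real.exp_log ha, Complex.ofReal_inv]
    have e3 : circleLocMatrix (Circle.exp (Complex.arg W))⁻¹ (Circle.exp θ' * (Circle.exp (Complex.arg W))⁻¹)⁻¹ =
        !![((starRingEnd ℂ) W / ‖W‖ + ζb * W / ‖W‖) / 2, ((starRingEnd ℂ) W / ‖W‖ - ζb * W / ‖W‖) / 2;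
           ((starRingEnd ℂ) W / ‖W‖ - ζb * W / ‖W‖) / 2, ((starRingEnd ℂ) W / ‖W‖ + ζb * W / ‖W‖) / 2] := by
      have hv : (((Circle.exp θ' * (Circle.exp (Complex.arg W))⁻¹)⁻¹ : Circle) : ℂ) = ζb * W / ‖W‖ := by
        rw [Circle.coe_inv, Circle.coe_mul, Circle.coe_inv, hu, Circle.coe_exp, mul_inv, inv_inv, ← Complex.exp_neg, ← hζb]
        ring
      have hu' : (((Circle.exp (Complex.arg W))⁻¹ : Circle) : ℂ) = (starRingEnd ℂ) W / ‖W‖ := by rw [Circle.coe_inv, hu, huinv]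
      rw [circleLocMatrix, hu', hv]
    rw [e1, e2, e3]
  obtain ⟨h10, h00⟩ := iwasawa_matrix_entries ha h1 hWform hWbform hn
  rw [hmat]
  exact ⟨h10, by rw [h00]; push_cast; ring⟩

variable [NumberField L] [IsCMField L]

/-! ## §3 The assembly -/

/-- **THE CIRCLE AVERAGE ALONG THE SINGLE-PLACE TORUS — pointwise shifted form.**  Under the letters (G) (K) (B), for `g = b₀ · adelicSingle w (circleLoc u₀ v₀) · k′` (global Iwasawa +
splitting), with `e^{iθ₁} = v₀∕u₀`:  `e^{−iqθ}·f(g·circleAt 1 (e^{iθ})·torusAt a) = v₀^q·(c_{b₀}·f(k′)·u₀^p) … ` — packaged directly as the INTEGRAL identity below. -/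
theorem circleAverage_torusAt_eq (f : (quasiSplit (↥(maximalRealSubfield L)) L (IsCMField.complexConj L) 2).Adelic → ℂ) (s : ℂ) (p q : ℤ)
    (hBglob : ∀ b ∈ borelAdelic (↥(maximalRealSubfield L)) L (IsCMField.complexConj L) 2, ∃ c : ℂ, ∀ x, f (b * x) = c * f x)
    (hK : ∀ x (u v : Circle), f (x * circleAt L w u v) = (u : ℂ) ^ p * (v : ℂ) ^ q * f x)
    (hB : ∀ (b : archLocal L 2 ((StdForm.antidiagonal 2).over L) w) (r : ℝ), 0 < r →
      (((b : GL (Fin 2) ℂ) : Matrix (Fin 2) (Fin 2) ℂ) 1 0 = 0) → (((b : GL (Fin 2) ℂ) : Matrix (Fin 2) (Fin 2) ℂ) 0 0 = (r : ℂ)) →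
      ∀ x, f (adelicSingle (↥(maximalRealSubfield L)) L (IsCMField.complexConj L) 2 ((StdForm.antidiagonal 2).over L) (IsCMField.complexConj_ne_one L)
        (complexConj_smul_infinitePlace L) w b * x) = ((r ^ 2 : ℝ) : ℂ) ^ s * f x)
    {a : ℝ} (ha : 0 < a) (g : (quasiSplit (↥(maximalRealSubfield L)) L (IsCMField.complexConj L) 2).Adelic) :
    ∫ θ in (0 : ℝ)..2 * π, Complex.exp (-((q : ℂ) * θ * Complex.I)) * f (g * circleAt L w 1 (Circle.exp θ) * torusAt L w a) =
      (∫ θ in (0 : ℝ)..2 * π, archTorusIntegrand s (p - q) a θ) * f g := by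
  -- global Iwasawa and the splitting of the compact factor at `w`
  obtain ⟨b₀, hb₀, k₀, hk₀, rfl⟩ := exists_mem_borelAdelic_mul_mem_standardMaximalCompactGL_cm L (N := 2) g
  obtain ⟨c₀, hc₀⟩ := hBglob b₀ hb₀
  obtain ⟨k', hk', hk₀eq⟩ := exists_eq_adelicSingle_mul (↥(maximalRealSubfield L)) L (IsCMField.complexConj L) 2 ((StdForm.antidiagonal 2).over L)
    (IsCMField.complexConj_ne_one L) (complexConj_smul_infinitePlace L) w k₀
  have hk₀K : k₀ ∈ ((standardMaximalCompactGL 2 L).comap (adelicVal ↥(maximalRealSubfield L) L (IsCMField.complexConj L) 2 ((StdForm.antidiagonal 2).over L)) :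
      Subgroup (quasiSplit (↥(maximalRealSubfield L)) L (IsCMField.complexConj L) 2).Adelic) := hk₀
  obtain ⟨u₀, v₀, hκ⟩ := exists_archAt_archPart_eq_circleLoc L w hk₀K
  rw [hκ] at hk₀eq
  -- notation: `ι = adelicSingle w`, the commuting element `k′`
  have hcomm : ∀ u : archLocal L 2 ((StdForm.antidiagonal 2).over L) w,
      k' * adelicSingle (↥(maximalRealSubfield L)) L (IsCMField.complexConj L) 2 ((StdForm.antidiagonal 2).over L) (IsCMField.complexConj_ne_one L)
        (complexConj_smul_infinitePlace L) w u =
      adelicSingle (↥(maximalRealSubfield L)) L (IsCMField.complexConj L) 2 ((StdForm.antidiagonal 2).over L) (IsCMField.complexConj_ne_one L)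
        (complexConj_smul_infinitePlace L) w u * k' := fun u =>
    (commute_adelicSingle_of_mem_awayFrom (↥(maximalRealSubfield L)) L (IsCMField.complexConj L) 2 ((StdForm.antidiagonal 2).over L)
      (IsCMField.complexConj_ne_one L) (complexConj_smul_infinitePlace L) w u hk').eq
  -- the phase `θ₁` with `e^{iθ₁} = v₀∕u₀`
  set θ₁ : ℝ := Complex.arg (((u₀⁻¹ * v₀ : Circle)) : ℂ) with hθ₁def
  have hθ₁C : Circle.exp θ₁ = u₀⁻¹ * v₀ := Circle.exp_arg _
  have hθ₁ : Complex.exp ((θ₁ : ℂ) * Complex.I) = (v₀ : ℂ) / (u₀ : ℂ) := by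
    rw [← Circle.coe_exp, hθ₁C, Circle.coe_mul, Circle.coe_inv, div_eq_inv_mul]
  have hu₀ : ((u₀ : Circle) : ℂ) ≠ 0 := Circle.coe_ne_zero u₀
  have hcommC : ∀ u v : Circle, circleAt L w u v * k' = k' * circleAt L w u v := fun u v => by
    rw [circleAt_def]; exact (hcomm _).symm
  -- `f(g)`
  have hfg : f (b₀ * k₀) = c₀ * ((u₀ : ℂ) ^ p * (v₀ : ℂ) ^ q * f k') := by
    rw [hc₀, hk₀eq, ← circleAt_def, hcommC, hK]
  -- the pointwise identity
  have hpt : ∀ θ : ℝ, Complex.exp (-((q : ℂ) * θ * Complex.I)) * f (b₀ * k₀ * circleAt L w 1 (Circle.exp θ) * torusAt L w a) =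
      (c₀ * ((u₀ : ℂ) ^ p * (v₀ : ℂ) ^ q * f k')) * archTorusIntegrand s (p - q) a (θ + θ₁) := by
    intro θ
    set W : ℂ := torusW a (θ + θ₁) with hWdef
    have hW : W ≠ 0 := torusW_ne_zero ha _
    -- the local Borel element and the rotated circle element
    set uu : Circle := Circle.exp (Complex.arg W) with huu
    set bL : archLocal L 2 ((StdForm.antidiagonal 2).over L) w :=
      circleLoc L w 1 (Circle.exp (θ + θ₁)) * torusLoc L w (Real.log a) * (circleLoc L w uu (Circle.exp (θ + θ₁) * uu⁻¹))⁻¹ with hbL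
    obtain ⟨h10, h00⟩ := localBorel_entries L w ha (θ + θ₁)
    -- group-level rearrangement: `k₀ · circleAt 1 ζ · torusAt a = ι(bL) · circleAt (uu·u₀) (ζ′uu⁻¹·u₀) · k′`
    have hgrp : k₀ * (circleAt L w 1 (Circle.exp θ) * torusAt L w a) =
        adelicSingle (↥(maximalRealSubfield L)) L (IsCMField.complexConj L) 2 ((StdForm.antidiagonal 2).over L) (IsCMField.complexConj_ne_one L)
          (complexConj_smul_infinitePlace L) w bL * (circleAt L w (uu * u₀) (Circle.exp (θ + θ₁) * uu⁻¹ * u₀) * k') := by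
      have hloc : circleLoc L w u₀ v₀ * circleLoc L w 1 (Circle.exp θ) * torusLoc L w (Real.log a) =
          bL * circleLoc L w (uu * u₀) (Circle.exp (θ + θ₁) * uu⁻¹ * u₀) := by
        rw [circleLoc_mul_circleLoc_one, show u₀⁻¹ * v₀ * Circle.exp θ = Circle.exp (θ + θ₁) by rw [Circle.exp_add, hθ₁C]; exact mul_comm _ _,
          mul_assoc, circleLoc_self_mul_comm, ← mul_assoc, hbL, circleLoc_mul L w uu u₀ (Circle.exp (θ + θ₁) * uu⁻¹) u₀, ← mul_assoc,
          inv_mul_cancel_right]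
      rw [hk₀eq, circleAt_def, torusAt_def, mul_assoc, ← map_mul, hcomm, ← mul_assoc, ← map_mul, ← mul_assoc (circleLoc L w u₀ v₀), hloc,
        map_mul, ← circleAt_def, mul_assoc]
    rw [mul_assoc (b₀ * k₀), mul_assoc b₀, hgrp, hc₀, hB bL (2 / ‖W‖) (by positivity) h10 h00, hcommC, hK]
    -- the scalars
    have hbr := bracket_eq s p q ha θ θ₁ hu₀ hθ₁
    have huuC : ((uu : Circle) : ℂ) = W / (‖W‖ : ℂ) := by
      have hn : (‖W‖ : ℂ) ≠ 0 := Complex.ofReal_ne_zero.2 (norm_ne_zero_iff.2 hW)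
      rw [huu, Circle.coe_exp, eq_div_iff hn, mul_comm]
      exact_mod_cast Complex.norm_mul_exp_arg_mul_I W
    rw [Circle.coe_mul, Circle.coe_mul, Circle.coe_mul, Circle.coe_inv, huuC, Circle.coe_exp, mul_zpow, mul_zpow]
    rw [← hWdef] at hbr
    push_cast at hbr ⊢
    linear_combination (c₀ * (u₀ : ℂ) ^ p * f k') * hbr
  -- integrate: constant out, then the `2π`-periodic shift
  simp_rw [hpt]
  rw [intervalIntegral.integral_const_mul, hfg]
  have hper := periodic_archTorusIntegrand s (p - q) a
  have hshift : (∫ θ in (0 : ℝ)..2 * π, archTorusIntegrand s (p - q) a (θ + θ₁)) = ∫ θ in (0 : ℝ)..2 * π, archTorusIntegrand s (p - q) a θ := by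
    rw [intervalIntegral.integral_comp_add_right (fun θ => archTorusIntegrand s (p - q) a θ) θ₁, zero_add,
      show 2 * π + θ₁ = θ₁ + 2 * π by ring, hper.intervalIntegral_add_eq θ₁ 0, zero_add]
  rw [hshift]
  ring

/-- **NORMALISED FORM: the circle average is `archTorusCoeff s (p − q) a · f(g)`** (★ F2a `archTorusCoeff = (2π)⁻¹ • ∫ archTorusIntegrand`). With `f := flatSectionU φ z`, `s := z + it_w` this is the
section half of the `hmc` letter of ★ `arch_unitarity_of_rightRegular_matrixCoeff`. [cite: Knapp1986, VII §1] [cite: MoeglinWaldspurger1995, IV.3] -/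
theorem circleAverage_torusAt_eq_archTorusCoeff_mul (f : (quasiSplit (↥(maximalRealSubfield L)) L (IsCMField.complexConj L) 2).Adelic → ℂ) (s : ℂ) (p q : ℤ)
    (hBglob : ∀ b ∈ borelAdelic (↥(maximalRealSubfield L)) L (IsCMField.complexConj L) 2, ∃ c : ℂ, ∀ x, f (b * x) = c * f x)
    (hK : ∀ x (u v : Circle), f (x * circleAt L w u v) = (u : ℂ) ^ p * (v : ℂ) ^ q * f x)
    (hB : ∀ (b : archLocal L 2 ((StdForm.antidiagonal 2).over L) w) (r : ℝ), 0 < r →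
      (((b : GL (Fin 2) ℂ) : Matrix (Fin 2) (Fin 2) ℂ) 1 0 = 0) → (((b : GL (Fin 2) ℂ) : Matrix (Fin 2) (Fin 2) ℂ) 0 0 = (r : ℂ)) →
      ∀ x, f (adelicSingle (↥(maximalRealSubfield L)) L (IsCMField.complexConj L) 2 ((StdForm.antidiagonal 2).over L) (IsCMField.complexConj_ne_one L)
        (complexConj_smul_infinitePlace L) w b * x) = ((r ^ 2 : ℝ) : ℂ) ^ s * f x)
    {a : ℝ} (ha : 0 < a) (g : (quasiSplit (↥(maximalRealSubfield L)) L (IsCMField.complexConj L) 2).Adelic) :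
    ((2 * π)⁻¹ : ℝ) • ∫ θ in (0 : ℝ)..2 * π, Complex.exp (-((q : ℂ) * θ * Complex.I)) * f (g * circleAt L w 1 (Circle.exp θ) * torusAt L w a) =
      archTorusCoeff s (p - q) a * f g := by
  rw [circleAverage_torusAt_eq L w f s p q hBglob hK hB ha g, archTorusCoeff_def, Complex.real_smul, Complex.real_smul]
  ring

end Summit.HodgeConjecture.HodgeConjecture.Cruxes.H413.K2E1ArchTorusActionFlatSectionU11

end
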